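/- LEAD seat `ym-line-cbag-p1` (prover-ym-line-cbag-p1-g29-0), LINE 7b (`GlueballBandRecursion`, volume-comparison line endorsed by the planner of
record 2026-08-28T19:59Z): the THERMAL FREE ENERGY of the spatial torus at complex coupling and the ONE combinatorial stub of the line — jet agreement
of the thermal free-energy density across spatial volumes — plus the floor statement it is paired with.  Definitions only (route-posited objects,
reviewed); consumed by `Theorems/GlueballBandRecursionVolumeComparisonOfJets.lean`.  Route-independent. -/
import Literature.MathematicalPhysics.QuantumFieldTheory.Balaban1983to89.InfiniteVolumeSufficientXII
import Literature.MathematicalPhysics.QuantumFieldTheory.YangMillsOS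

/-!
# Route `GlueballBandRecursion`, line 7b: the thermal free energy of the spatial torus at complex coupling; the jet stub

Objects (for a compact group `G`, a continuous matrix representation `ρ`, the cubic spatial torus `(ℤ/a)³` and the Euclidean period `t`),
all read through the tree's periodic-box plaquette system `boxSystem ρ ![a, a, a, t]` on `zdHaar 4 G` (`PeriodicBoxPlaqSystem`):
* `tubeLogZ ρ a t z` — the cluster-expansion logarithm `log Z(a³ × t)(z)` (`pertLogZ`, holomorphic and bounded on the strong-coupling disc,
  `Re = log Z_β(a³×t) = log cyclicPartition ρ β a t` at real `β`, module XII's dictionary);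
* `tubeRate ρ a z := lim_{k→∞} tubeLogZ ρ a (k+1) z / (k+1)` — the tube rate `e_a(z)` of `PeriodicBoxFreeEnergyLimits.exists_tube_rate`
  (`‖log Z(a³×t) − t e_a‖ ≤ 12a³te^{−⌊t/2⌋}`; `Re e_a(β) = log λ₊(β, a)` at real `β` by the spectral squeeze), made a NAMED function;
* `thermalLogZ ρ a t z := tubeLogZ ρ a t z − t · tubeRate ρ a z` — the thermal free energy: at real `β` its real part is
  `log Z_β(a³×t) − t log λ₊(β,a) = log(1 + traceExcess ρ β a t)`;
* `volumeDiscrepancy ρ a a' t z := thermalLogZ ρ a' t z / a'³ − thermalLogZ ρ a t z / a³` — the difference of thermal free-energy DENSITIES of two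
  spatial volumes at the same period: the quantity whose smallness IS the volume comparison `TraceExcessVolumeComparisonSmallCoupling`.
Statements (OPEN, `def … : Prop`, nothing asserted):
* `ThermalFreeEnergyVolumeJets` — **stub #1 of line 7b (the closedness count)**: for `4 ≤ a ≤ a'`, `4 ≤ t` the volume discrepancy vanishes at
  `z = 0` to order `3a`: `volumeDiscrepancy ρ a a' t =O[𝓝 0] z^{3a}`.  TRUE to order `4a` (sketch): the Taylor coefficients of `log Z(a³×t)` are Haar
  joint cumulants of plaquette costs; a cumulant vanishes unless its support is link-connected with NO FREE BOND (one-bond Haar invariance makes a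
  plaquette with a private bond independent of the rest); a no-free-bond family meets every crossed dual slice `x_i = c + ½` in a subgraph of minimum
  degree `2` of the slice graph `(ℤ/t) × (ℤ/a)²`, hence in `≥ girth = 4` plaquettes (`t, a ≥ 4`); so families with `< 4a` members do not wind or span
  the spatial torus, lift to `(ℤ/t) × ℤ³` with exactly `a³` translates and the same cumulant, and the coefficients of `log Z(a³×t)/a³` and (letting the
  period go to infinity) of `e_a/a³` are `a`-independent below order `4a`.  The exponent `3a` leaves slack; ANY exponent `≥ (1+ε)a` serves the assembly.
  The tree's `PlaqSystem` expansion (weights `e^{−z·cost} − 1`, connectivity-only counting) certifies only order `≈ a`, one short of the floor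
  `β^{4⌊a/4⌋}` — closedness is load-bearing.
* `TraceExcessFloorAllSides` — the volume-uniform floor `(c₁β⁴)^{m+2} ≤ traceExcess r.ρ β N (m+2)` for ALL sides `N ≥ N₀` on an engine window
  `(0, βF]`, for every compact `G` whose faithful representation has non-constant real character (every nontrivial `G`).  The tree has the odd-side
  instance for compact simple Lie `G` (`Cruxes.IR.VolumeMonotone.traceExcess_floor_strongCoupling_uniform`); the all-sides form is the same proof
  (`SCFloor.facingPlaquetteCorr_floor` + `traceExcess_floor_of_facingCov` + `Cruxes.IR.StrongCouplingRate.log_one_add_traceExcess_le_rate`).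
`Theorems/GlueballBandRecursionVolumeComparisonOfJets.lean` proves `ThermalFreeEnergyVolumeJets → TraceExcessFloorAllSides →
TraceExcessVolumeComparisonSmallCoupling` (Schwarz lemma with multiplicity on the strong-coupling disc + the floor), whence
`ColdDoublingRecursionSmallCoupling` by `coldDoublingRecursionSmallCoupling_of_volumeComparison`.

HONEST FRAMING.  Definitions; nothing is proved here.  The two statements are OPEN (the second is in reach of the tree).  The target is the ∃-window
strong-coupling rung `ColdDoublingRecursionSmallCoupling` (RECORD-type); nothing here bears on weak coupling or on the Yang–Mills mass gap.
-/

set_option autoImplicit false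

noncomputable section

open Filter Topology Asymptotics MeasureTheory
open Literature.Probability.LatticeModels (pertLogZ)
open Literature.MathematicalPhysics.QuantumFieldTheory
open Literature.MathematicalPhysics.QuantumFieldTheory.Balaban1983to89.Missing (strongCouplingRadius)

namespace Summit.QuantumFields.YangMills.Theorems.GlueballBandRecursion.Thermal

section Defs

variable {G : Type*} [Group G] [TopologicalSpace G] [IsTopologicalGroup G] [CompactSpace G] [MeasurableSpace G] [BorelSpace G]
  {n : ℕ} (ρ : G →* Matrix (Fin n) (Fin n) ℂ)

open scoped Classical in
/-- `log Z(a³ × t)(z)`: the cluster-expansion logarithm (`pertLogZ`) of the partition function of the periodic box `a × a × a × t` at complex coupling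
`z`, over the tree's box plaquette system on `zdHaar 4 G`. -/
def tubeLogZ (a t : ℕ) (z : ℂ) : ℂ :=
  pertLogZ (zdHaar 4 G) ((boxSystem (G := G) ρ (![a, a, a, t] : Fin 4 → ℕ)).weight z)
    (boxSystem (G := G) ρ (![a, a, a, t] : Fin 4 → ℕ)).Adj Finset.univ

/-- The tube rate `e_a(z) = lim_{k → ∞} log Z(a³ × (k+1))(z)/(k+1)` — the free energy per unit Euclidean time of the spatial torus `(ℤ/a)³`
(the limit exists on the strong-coupling disc, `PeriodicBoxFreeEnergyLimits.exists_tube_rate`; at real `β ≥ 0`, `Re e_a(β) = log λ₊(β, a)`). -/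
def tubeRate (a : ℕ) (z : ℂ) : ℂ :=
  limUnder atTop fun k : ℕ => tubeLogZ ρ a (k + 1) z / ((k + 1 : ℕ) : ℂ)

/-- The thermal free energy `log Z(a³ × t)(z) − t · e_a(z)` of the spatial torus `(ℤ/a)³` at period `t` (at real `β`: `log(1 + traceExcess ρ β a t)`). -/
def thermalLogZ (a t : ℕ) (z : ℂ) : ℂ :=
  tubeLogZ ρ a t z - (t : ℂ) * tubeRate ρ a z

/-- The volume discrepancy of the thermal free-energy DENSITY between the spatial tori `(ℤ/a')³` and `(ℤ/a)³` at the same period `t`. -/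
def volumeDiscrepancy (a a' t : ℕ) (z : ℂ) : ℂ :=
  thermalLogZ ρ a' t z / ((a' : ℂ) ^ 3) - thermalLogZ ρ a t z / ((a : ℂ) ^ 3)

end Defs

/-- **Stub #1 of line 7b — jet agreement of the thermal free-energy density across spatial volumes (the closedness count).**  For every compact
`G`, faithful unitary `r`, and `4 ≤ a ≤ a'`, `4 ≤ t`: `volumeDiscrepancy r.ρ a a' t =O[𝓝 0] (z ↦ z^{3a})` — the Taylor coefficients at `z = 0` of
the thermal free-energy densities of the two volumes agree below order `3a` (in truth below `4a`: no-free-bond supports with `< 4a` plaquettes neither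
wind nor span a spatial torus of side `a`, girth-`4` slab count).  Pure finite combinatorics of Haar joint cumulants on periodic boxes; per-volume
constants are irrelevant (the Schwarz lemma with the tree's volume-uniform bound turns it into the estimate).  OPEN. -/
def ThermalFreeEnergyVolumeJets : Prop :=
  ∀ (G : Type) [Group G] [TopologicalSpace G] [IsTopologicalGroup G] [CompactSpace G],
    letI : MeasurableSpace G := borel G
    haveI : BorelSpace G := ⟨rfl⟩
    ∀ (r : LatticeRep G) (a a' t : ℕ), 4 ≤ a → a ≤ a' → 4 ≤ t →
      (fun z : ℂ => volumeDiscrepancy r.ρ a a' t z) =O[𝓝 (0 : ℂ)] fun z : ℂ => z ^ (3 * a)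

/-- **The volume-uniform floor on all sides.**  For every compact `G` and faithful unitary `r` with NON-CONSTANT real character (every nontrivial
`G`) there are an engine window `βF > 0`, a constant `c₁ > 0` and a side threshold `N₀` with `(c₁β⁴)^{m+2} ≤ traceExcess r.ρ β N (m+2)` for all
`0 < β ≤ βF`, all sides `N ≥ N₀` and all `m` — the second transfer eigenvalue of every large spatial torus is `≥ c₁β⁴·λ₊`.  In reach of the tree
(odd-side instance: `Cruxes.IR.VolumeMonotone.traceExcess_floor_strongCoupling_uniform`). -/
def TraceExcessFloorAllSides : Prop :=
  ∀ (G : Type) [Group G] [TopologicalSpace G] [IsTopologicalGroup G] [CompactSpace G],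
    letI : MeasurableSpace G := borel G
    haveI : BorelSpace G := ⟨rfl⟩
    ∀ r : LatticeRep G, (∃ g h : G, (r.ρ g).trace.re ≠ (r.ρ h).trace.re) →
      ∃ βF c₁ : ℝ, ∃ N₀ : ℕ, 0 < βF ∧ 0 < c₁ ∧
        ∀ β : ℝ, 0 < β → β ≤ βF → ∀ (N : ℕ) [NeZero N], N₀ ≤ N → ∀ m : ℕ,
          (c₁ * β ^ 4) ^ (m + 2) ≤ traceExcess r.ρ β N (m + 2)

/-! ## Appendix (v2, same seat, append-only): the FINITE currency of line 7b (width seat w2 g23's remark R1, 2026-08-28T20:14Z)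

The cold period-doubling defect needs no tube rate: `2·log Z(a³×t) − log Z(a³×2t) = −log(1 − δᶜ_t(a))`,
`δᶜ_t(a) = 1 − Z(a³×2t)/Z(a³×t)²`, and the `t·e_a` normalisers cancel (`2t − 2t = 0`).  So the crew may prove jet agreement for the
difference of TWO FINITE BOXES per volume (no limit `e_a`, no Vitali), and the LEAD's second assembly
(`Theorems/GlueballBandRecursionColdDefectComparisonOfJets.lean`) turns it into `TraceExcessVolumeComparisonSmallCoupling` as well. -/

section DefsFinite

variable {G : Type*} [Group G] [TopologicalSpace G] [IsTopologicalGroup G] [CompactSpace G] [MeasurableSpace G] [BorelSpace G]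
  {n : ℕ} (ρ : G →* Matrix (Fin n) (Fin n) ℂ)

/-- The cold log-defect `2·log Z(a³×t)(z) − log Z(a³×2t)(z)` of the spatial torus `(ℤ/a)³` at period `t` (at real `β ≥ 0`:
`−log(1 − δᶜ_t(a))` with `δᶜ_t(a) = 1 − Z_β(a³×2t)/Z_β(a³×t)²`; equals `2·thermalLogZ ρ a t z − thermalLogZ ρ a (2t) z`). -/
def coldLogDefect (a t : ℕ) (z : ℂ) : ℂ :=
  2 * tubeLogZ ρ a t z - tubeLogZ ρ a (2 * t) z

/-- The volume discrepancy of the cold log-defect DENSITY between the spatial tori `(ℤ/a')³` and `(ℤ/a)³` at the same period `t`. -/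
def coldVolumeDiscrepancy (a a' t : ℕ) (z : ℂ) : ℂ :=
  coldLogDefect ρ a' t z / ((a' : ℂ) ^ 3) - coldLogDefect ρ a t z / ((a : ℂ) ^ 3)

end DefsFinite

/-- **Stub #1 of line 7b in the finite currency — jet agreement of the cold log-defect density across spatial volumes.**  For every compact
`G`, faithful unitary `r`, and `4 ≤ a ≤ a'`, `4 ≤ t`: `coldVolumeDiscrepancy r.ρ a a' t =O[𝓝 0] (z ↦ z^{3a})`.  Same content and same proof as
`ThermalFreeEnergyVolumeJets` (closedness by support + girth-`4` slab count + lifting), but over the two finite boxes `a³×t`, `a³×2t` only (w2 g23's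
R1: no tube rate).  Either stub feeds an assembly of the line.  OPEN. -/
def ColdFreeEnergyVolumeJets : Prop :=
  ∀ (G : Type) [Group G] [TopologicalSpace G] [IsTopologicalGroup G] [CompactSpace G],
    letI : MeasurableSpace G := borel G
    haveI : BorelSpace G := ⟨rfl⟩
    ∀ (r : LatticeRep G) (a a' t : ℕ), 4 ≤ a → a ≤ a' → 4 ≤ t →
      (fun z : ℂ => coldVolumeDiscrepancy r.ρ a a' t z) =O[𝓝 (0 : ℂ)] fun z : ℂ => z ^ (3 * a)

end Summit.QuantumFields.YangMills.Theorems.GlueballBandRecursion.Thermal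

end
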